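import Mathlib
import HarnessLib
import HarnessLib.Audit
import Summits.NavierStokesRegularity.Statement
import Literature.Analysis.FluidPDE.ClassicalSolution
import Literature.Analysis.FluidPDE.LerayHopf
import Literature.Analysis.FluidPDE.SuitableWeak
import Literature.Analysis.FluidPDE.VectorCalculus
import HarnessLib.Audit.Status.Attr

/-!
Route: VortexLineClock

# Route VortexLineClock — frozen vortex-line clocks empty the Euler window and forbid self-similar
inviscid Type-II cores

X = TypeIIWindowCore ∧ EmptyEulerWindow ("it suffices to show"; card
vortex-line-clock-euler-window). TypeIIWindowCore (NS side,
card K1): a finite-energy classical solution from Clay data with finite maximal lifespan T and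
NON-Type-I rate admits an Euler-scaling
zoom (centres x_k, vorticity amplitude A_k = |ω(t_k,x_k)| → ∞, half-max core radius ℓ_k → 0, local
Reynolds number A_k ℓ_k²/ν → ∞)
whose rescaled vorticity converges in C¹_loc to the normalised vorticity Ω of an EXACT self-similar
Euler WINDOW PROFILE: 2/5 ≤ γ < 1/2,
U ∈ C², Ω ∈ C¹, div U = 0, mΩ = curl U, U and Ω globally Lipschitz, the stationary self-similar
Euler system in velocity and vorticity
form about a centre c, CIV matched decay |Ω| ≲ ⟨y⟩^(−1/γ), |U| ≲ ⟨y⟩^(1−1/γ), |Ω(0)| = 1.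
EmptyEulerWindow (Euler side): no such
window profile exists — decomposed (support WindowGlue, pure logic) as FluxCapacityRecurrence (thin
flux ⇒ a.e. vortex line of Ω
recurrent; provable) → SeifertResidual (recurrence ⇒ a closed vortex line; the open residual) →
ProfileClockNoCycle (the self-similar
vortex-line CLOCK: [V,Ω] = −(1+γ)Ω with V = γ(y−c)+U conjugates Ω to e^((1+γ)τ)Ω, so one closed
vortex line yields arbitrarily short
ones, against Yorke's period bound 2π/Lip Ω; provable). X gives the shared target NoTypeII
(stmt-0056) by pure logic; with the shared
Type-I half NoTypeIBlowup (stmt-1217) and NoBlowupToClay (stmt-0055) it gives Clay (A) (glue.lean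
`closes`, lean check rc 0, 0 sorry).
Lean: `TypeIIWindowCore ∧ EmptyEulerWindow`

## Assembly
Pure logic (glue.lean `closes`, lean check rc 0, 0 sorry, axioms
propext/Classical.choice/Quot.sound): apply NoBlowupToClay; given a
Leray–Hopf classical solution on [0,T) from a rapidly decaying datum with no smooth extension past
T, it is maximal; if it is Type I,
NoTypeIBlowup extends it — contradiction; if not, TypeIIWindowCore produces (γ,U,Ω) with the window
clauses and EmptyEulerWindow denies
them — contradiction. SeifertResidual, FluxCapacityRecurrence, ProfileClockNoCycle feed
EmptyEulerWindow through WindowGlue;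
YorkePeriodBound, EulerClockBound and InviscidVorticityCore are engine / falsifier items and do not
enter `closes`.

Rationale: WHY THIS LINE. Euler transports vorticity as a vector field, ω(t) = (Φ_t)_*ω₀, so the vortex-line
flow x' = ω(x,t) is C¹-conjugate to its initial
state and every conjugacy invariant carrying a power of time — periods ∮ds/|ω| of closed vortex
lines, return times, entropy — is
frozen, while a blow-up zoom must speed it up without bound; for an exact self-similar profile the
same clock is internal
(ConstantinIgnatovaVicol2026Putative §3.4.1 Cauchy formula read as an Aff(1)-action, closed by
Yorke1969), and CIV's matched decay makes
the vorticity flux through large spheres vanish (R^(2−1/γ) → 0 for γ < 1/2), forcing a.e. recurrence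
of vortex lines exactly where the
clock forbids closed ones. Imported areas: Lagrangian/geometric fluid mechanics (Cauchy formula,
Chae2007CMPEuler-type transport vs
self-similarity), ODE dynamics (Yorke1969 period bound, Hopf decomposition / Poincaré recurrence for
volume-preserving flows,
Seifert-type closed-orbit problems Kuperberg1996, EtnyreGhrist2000), blow-up rescaling of Type II at
the Euler scaling (Seregin2024,
ConstantinIgnatovaVicol2026Putative Prop 3.1). What it adds: CIV Thms 3.8/3.10/4.4/4.6 empty the
window γ < 1/2 only under the OUTGOING
property (or axisymmetry); this line attacks the non-outgoing remainder with a new invariant (the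
vortex-line clock, weight 1+γ, never
mute — unlike circulation, weight 1−2γ, mute at γ = 1/2), and no open route
(TypeIIInviscidRelaxation: inviscid damping; CoreLogGas: tube
gas dynamics; ClockStretchingLaw: Type-I time-translation mode) uses dynamical invariants of vortex
lines; negatives index empty.

RANKED CRUXES. #0 NoTypeII (target) — shared target stmt-NavierStokesRegularity-0056: a
finite-energy classical solution from a rapidly decaying datum with finite maximal lifespan T blows
up at the Type-I rate ‖u(t)‖∞ ≤ C(T−t)^(−1/2); here it follows from TypeIIWindowCore ∧
EmptyEulerWindow by pure logic (Sketch.lean `target_of_cruxes`). (why it might fail: a finite-energy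
Type-II singularity (= ¬Clay A); Tao's averaged blow-up is Type II (arXiv:1402.0290 p.8 fn.), Hou's
axisymmetric scenario (arXiv:2107.06509) would be Type II if singular.) [Tao2016AveragedNS,
Hou2022PotentiallySingularNS, KochNadirashviliSereginSverak2009, Seregin2024]
#2 TypeIIWindowCore (crux) — card K1 (INVISCID CORE EXTRACTION, typed in its exact-profile form):
for ν, T > 0 and a maximal classical solution (u,p) on [0,T) that is Leray–Hopf from a rapidly
decaying datum and NOT Type I, there are γ, U, Ω with the WINDOW-PROFILE clauses (2/5 ≤ γ < 1/2; U
C², Ω C¹; div U = 0; mΩ = curl U for some m > 0; U, Ω globally Lipschitz; ∃ c, P: (1−γ)U +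
DU(γ(y−c)+U) + ∇P = 0 and DΩ(γ(y−c)+U) − DU(Ω) = −Ω; |Ω(y)| ≤ C⟨y⟩^(−1/γ), |U(y)| ≤ C⟨y⟩^(1−1/γ);
|Ω(0)| = 1) AND a zoom t_k ↑ T, x_k, A_k = |curl u(t_k)(x_k)| → ∞, half-max core radii ℓ_k → 0,
isometries Q_k, with A_k ℓ_k²/ν → ∞ and y ↦ A_k⁻¹ Q_k⁻¹ curl u(t_k)(x_k + ℓ_k Q_k y) → Ω in C¹ on
every ball. [difficulty: open-problem] (why it might fail: Type II may be wild, DSS or multiscale: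
Seregin's Euler-scaling limits are only weak ancient Euler flows with C⁰-velocity compactness;
reconnection layers break C¹-vorticity convergence; an EXACT globally Lipschitz decaying profile is
full asymptotic self-similarity.) [Seregin2024, arXiv:2304.04045,
ConstantinIgnatovaVicol2026Putative, arXiv:2602.17570, Hou2022PotentiallySingularNS,
ChaeShvydkoy2013]
#3 EmptyEulerWindow (crux) — THE EULER WINDOW IS EMPTY: there is no (γ, U, Ω) satisfying the
window-profile clauses of TypeIIWindowCore — no exact self-similar Euler blow-up profile with 2/5 ≤
γ < 1/2, Lipschitz normalised vorticity and CIV matched decay. Known: γ ≥ 2/5 is forced by finite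
energy (CIV Thm 2.1); under the local OUTGOING property γ ≥ 1/2 (CIV Thms 3.8, 3.10), axisymmetric
cases (CIV Thms 4.4, 4.6); open: profiles whose self-similar Lagrangian field V = γ(y−c)+U has
non-outgoing stagnation points or an infinite nodal set. Intended proof = WindowGlue:
FluxCapacityRecurrence → SeifertResidual → ProfileClockNoCycle. [difficulty: open-problem] (why it
might fail: a Lipschitz window profile with saddle-type (non-outgoing) stagnation points may exist —
constructions need outgoing (arXiv:2511.16254 Hyp. 6.7) but nothing forbids it; the dynamical proof
needs a closing lemma false for general C¹ volume-preserving flows (Kuperberg1996).)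
[ConstantinIgnatovaVicol2026Putative, arXiv:2602.17570, arXiv:2511.16254, ChaeShvydkoy2013,
Chae2007CMPEuler, Elgindi2021AnnMath, Kuperberg1996]
#4 InviscidVorticityCore (crux) — TYPE II HAS AN INVISCID VORTICITY CORE (the first, zoom-free
consequence of TypeIIWindowCore; Sketch.lean `inviscidCore_of_windowCore`): for a maximal Leray–Hopf
classical solution from rapidly decaying data with non-Type-I rate, for every K and every t₀ < T
there are t ∈ (t₀,T), a point x and its half-max vorticity core radius ℓ (|curl u(t)| > |curl
u(t)(x)|/2 on the open ball B(x,ℓ), ≤ at some point of its boundary sphere) with |curl u(t)(x)| ≥ K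
and local Reynolds number |curl u(t)(x)|·ℓ²/ν ≥ K. [difficulty: L] (why it might fail: a Type-II
blow-up could keep every intense vorticity core at the viscous scale (|ω|ℓ² ≲ ν: sheets/filaments of
Kolmogorov thickness) while ‖u‖∞ outruns (T−t)^(−1/2) by accumulation of many cores (cascade-like);
no known estimate ties the rate to the core Reynolds number.) [Seregin2024, arXiv:2304.04045,
Hou2022PotentiallySingularNS, KochNadirashviliSereginSverak2009,
ConstantinIgnatovaVicol2026Putative]
#9 SeifertResidual (support) — card K2 (SEIFERT RESIDUAL), the open residual form of
EmptyEulerWindow: a window profile (clauses as in TypeIIWindowCore) whose vortex-line flow is a.e.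
recurrent on {Ω ≠ 0} (the conclusion of FluxCapacityRecurrence) has a closed vortex line: a
τ-periodic solution of x' = Ω(x), τ > 0, through a point where Ω ≠ 0. Engines: contact/Reeb
structure where U·Ω ≠ 0 (EtnyreGhrist2000), twist ⇒ Poincaré–Birkhoff, the affine pair [V,Ω] =
−(1+γ)Ω transporting recurrence to infinity, analyticity at Lagrangian stagnation points (CIV Prop
3.9). [difficulty: open-problem] [Kuperberg1996, EtnyreGhrist2000,
ConstantinIgnatovaVicol2026Putative]
#9 FluxCapacityRecurrence (support) — card P3, corrected from 'bounded' to 'recurrent' (FLUX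
CAPACITY): for a window profile, div Ω = 0, Ω is globally Lipschitz (complete volume-preserving
vortex-line flow) and ∫_(S_R) |Ω| dσ ≤ 4πC R^(2−1/γ) → 0 (1/γ > 2), so the forward-escaping set is
Lebesgue-null (last-exit flux count: vol ≤ (occupation bound)² × flux → 0), the flow is
conservative, and by Poincaré–Halmos recurrence a.e. point y with Ω(y) ≠ 0 returns arbitrarily close
to itself at arbitrarily late times along its (unique) vortex line. [difficulty: provable-now]
[ConstantinIgnatovaVicol2026Putative, MajdaBertozzi2002, Kuperberg1996]
#9 ProfileClockNoCycle (support) — card P2 (EXACT-PROFILE CLOCK THEOREM, stated for the bare affine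
structure): if U, Ω ∈ C¹(ℝ³;ℝ³) are globally Lipschitz, γ ≠ −1, and DΩ(γ(y−c)+U) − DU(Ω) = −Ω (i.e.
[V,Ω] = −(1+γ)Ω for the complete field V = γ(y−c)+U), then x' = Ω(x) has no non-stationary periodic
orbit: the flow Ψ_τ of V maps Ω-orbits to Ω-orbits with periods multiplied by e^(−(1+γ)τ) (d/ds
Ψ_τ(x(s)) = e^((1+γ)τ) Ω(Ψ_τ(x(s))) by uniqueness for the linearised equation), so one closed vortex
line of period p gives closed lines of every period p·e^(−(1+γ)τ), contradicting YorkePeriodBound.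
[difficulty: provable-now] [Yorke1969, ConstantinIgnatovaVicol2026Putative, arXiv:2602.17570]
#9 YorkePeriodBound (support) — Yorke 1969: a non-stationary τ-periodic solution of x' = F(x) with F
L-Lipschitz on ℝ³ has τ ≥ 2π/L (Wirtinger's inequality applied to x', whose derivative is a.e.
bounded by L|x'|). [difficulty: provable-now] [Yorke1969]
#9 EulerClockBound (support) — card P1 (EULER CLOCK THEOREM): for a classical Euler solution on ℝ³ ×
[0,T) with velocity gradient bounded on compact sub-intervals (so the Lagrangian flow is a C¹
diffeomorphism and the Cauchy formula ω(t)∘Φ_t = DΦ_t·ω₀ holds), and ‖∇ω₀‖∞ ≤ L, every closed vortex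
line of ω(t) = curl u(t), 0 ≤ t < T, has period ∮ds/|ω| ≥ 2π/L: periods are conjugacy invariants of
the frozen line field and Yorke bounds them at t = 0. The mechanism at home; corollary: no
C¹_loc-asymptotically self-similar Euler blow-up whose profile carries a non-degenerate closed
vortex line. [difficulty: provable-now] [MajdaBertozzi2002, Yorke1969, Chae2007CMPEuler,
CordobaFefferman2001]
#9 WindowGlue (support) — pure-logic glue of the Euler side (proved in Sketch.lean
`windowGlue_holds`): FluxCapacityRecurrence → SeifertResidual → ProfileClockNoCycle →
EmptyEulerWindow (unpack the window clauses; γ ≠ −1 from 2/5 ≤ γ). [difficulty: provable-now]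
[ConstantinIgnatovaVicol2026Putative]
#9 NoTypeIBlowup (support) — shared stmt-NavierStokesRegularity-1217 (the Type-I half, owned by the
Liouville programme: TypeILiouville 0057+0058, ThreadingFlux, ClockStretchingLaw …): a Leray–Hopf
classical solution from a rapidly decaying datum that blows up at most at the Type-I rate extends
smoothly past T. [difficulty: open-problem] [KochNadirashviliSereginSverak2009, AlbrittonBarker2019,
SereginSverak2009]
#9 NoBlowupToClay (support) — shared stmt-NavierStokesRegularity-0055: given no blow-up for
Leray–Hopf classical solutions from rapidly decaying data, build the Clay (A) solution (local
classical theory, continuation, weak–strong uniqueness, energy inequality,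
Literature.Analysis.FluidPDE.isNavierStokesSolution_and_smooth_iff). [difficulty: provable-now]
[Leray1934, KochNadirashviliSereginSverak2009, Fefferman2000]

TWO-LAYER PLAN. Foreseen glued splits (nothing filed now): EmptyEulerWindow ⇐ FluxCapacityRecurrence
→ SeifertResidual → ProfileClockNoCycle (the
support items already state the children; file `--split EmptyEulerWindow` once one of them closes);
SeifertResidual ⇐ (contact branch:
U·Ω ≠ 0 on the recurrent set ⇒ Reeb-type closed orbit) → (integrable branch: first integral /
invariant tori ⇒ twist or isochronous
⇒ closed orbit or linear conjugacy contradiction with the affine pair); TypeIIWindowCore ⇐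
InviscidVorticityCore-type extraction with
C¹_loc compactness of rescaled vorticity → rigidity (the limit solves the stationary self-similar
system with matched decay). Fallback if
TypeIIWindowCore dies on non-self-similar Type II (Architecture II, recorded in NOTES.md): C¹ core
compactness + FROZEN-CLOCK TRANSFER
(card K3: periods of closed vortex lines inside an Euler-scaling NS core are asymptotically
conserved) + robust recurrence of the limit
slice — NOT filed because robust recurrence fails for degenerate profiles (no-swirl ring vorticity
plus a small axial strain has no closed
lines). DSS profiles: the clock argument is identical with the discrete factor λ^(1+γ); add as a
disjunct of the window class if needed.

KILL CRITERIA. A window profile exhibited (constructed or numerically certified: Lipschitz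
self-similar Euler profile with 2/5 ≤ γ < 1/2 and CIV
decay) refutes EmptyEulerWindow: close `refuted:EmptyEulerWindow` and hand the witness to the
negative side (card
euler-window-viscous-transfer: it is a Type-II NS blow-up mechanism). InviscidVorticityCore refuted
(a rigorous Type-II scenario with
O(1) Reynolds number at the vorticity maximum) refutes TypeIIWindowCore with it: close
`refuted:InviscidVorticityCore`.
TypeIIWindowCore refuted alone (a rigorous non-self-similar Type-II core): pivot to Architecture II
(frozen-clock transfer) or retire.
FluxCapacityRecurrence or ProfileClockNoCycle refuted: the mechanism is wrong — retire at once (they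
are claimed theorems). A
finite-energy Type-II blow-up from Schwartz data refutes the target and settles ¬(A). NoTypeII
proved elsewhere moots the NS side (the
Euler-side items remain of independent value); NoBlowup proved elsewhere moots the route.

NOT DECOMPOSED YET. How TypeIIWindowCore would be proved (choice of zoom, C^(1,α) bounds on rescaled
vorticity at diverging local Reynolds number, passage
of the NS zoom to the stationary self-similar Euler system, the finite-energy bound 2/5 ≤ γ à la CIV
Thm 2.1, global Lipschitz/decay of
the limit); the engines inside SeifertResidual (contact vs integrable dichotomy, behaviour at
Lagrangian stagnation points, use of
analyticity); the Lean infrastructure for flows of Lipschitz fields (C¹ dependence on initial data,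
volume preservation, Hopf
decomposition) needed by the provable-now supports; the DSS variant of the window class; entropy and
return-time versions of the clock
(h_top scales by e^((1+γ)τ) under Ψ_τ, hence vanishes on compact invariant sets) — all layer-2 or
prover-side.

CHEAPEST FALSIFIER. (1) The two three-line arguments: ProfileClockNoCycle (pushforward of Ω-orbits
by the V-flow rescales Ω-time by e^((1+γ)τ); Yorke) and
the flux count of FluxCapacityRecurrence — a refuter checks the sign/weight bookkeeping ([V,Ω] =
DΩ·V − DV·Ω = −(1+γ)Ω from the
vorticity profile equation; done by the card audit and re-derived here). (2) Lookup, DONE at filing: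
Elgindi 2025 (arXiv:2511.16254, Hyp. 6.7 + Meta Theorem p.14) needs the OUTGOING field U_*+λ_*x for
constructing true profiles from approximate ones, and CIV Thm 3.8 makes outgoing incompatible with γ
< 1/2 when Ω(0) ≠ 0; the numerical
γ < 1/2 profiles (WLGZB23 = PRL 130:244002, WangEtAl25 = arXiv:2509.14185) live on domains WITH
BOUNDARY, outside the window class. So no
non-outgoing whole-space Lipschitz profile is in print; the next cheapest kill is to exhibit one
(refuter: Newton/NN search seeded at a
saddle-type centre). (3) kit-able but not run (no profile data in the store):
integrate vortex lines of any published collapsing core (Hou 2022 rescaled profile, Kerr, Kida–Pelz)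
and look for persistent short closed
lines inside the Euler-scaling core.

NUMBERS. Window: 2/5 ≤ γ < 1/2 (γ ≥ 2/5 from finite energy, CIV Thm 2.1; γ < 1/2 ⟺ local Reynolds
(T−t)^(2γ−1)/ν → ∞; CIV Prop 3.1: an
approximately self-similar NS blow-up has γ ≤ 1/2). Decay exponents: |Ω| ~ |y|^(−1/γ) with 1/γ ∈ (2,
5/2], |U| ~ |y|^(1−1/γ) (CIV
(3.7)); vorticity flux through S_R ≲ R^(2−1/γ) → 0. Clock weight 1+γ ∈ [7/5, 3/2) vs Kelvin weight
1−2γ ∈ (0, 1/5] (CIV Rem 3.6).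
Yorke constant 2π/L (sharp in Hilbert space). CIV Thm 3.8: outgoing with constant c_* and Ω(y_*) ≠ 0
⇒ γ ≥ 1/2 + c_*. Kuperberg1996: C¹
volume-preserving aperiodic flow on S³ exists; C^∞ volume-preserving Seifert open. Items at open: 13
(3 cruxes, 1 target, 1 assembly,
8 support; 3 shared: stmt-0056, stmt-1217, stmt-0055).

DEFINITION REQUESTS. None load-bearing: closed vortex line, a.e. recurrence and the window-profile
class are inlined (identical text in TypeIIWindowCore,
EmptyEulerWindow, SeifertResidual, FluxCapacityRecurrence so the glue is pure logic). Worth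
factoring later (definition item to be filed
against EmptyEulerWindow): `IsSelfSimilarEulerProfile γ c U Ω P` (CIV (3.3)–(3.4) with decay (3.7))
in Literature/Analysis/FluidPDE, and
a named fact for Yorke1969 if YorkePeriodBound is not simply proved.

Novelty: Searches (2026-08-15): `lit read arxiv:2602.17570` pp.3–12 (Thms 2.1, 3.4, 3.8, 3.10, Prop 3.9,
§3.4.1–3.5, 4.x read: outgoing /
axisymmetric cases only; no vortex-line dynamics); `lit frontier NavierStokesRegularity --since
2024` (30 rows: non-uniqueness, forward
self-similar, ε-regularity — none on Euler self-similar profiles or vortex-line invariants); `lit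
search --source arxiv "self-similar
Euler profile stagnation point outgoing gamma one half"` (0); `lit search --source zbmath
"volume-preserving flow without periodic orbits
Seifert conjecture smooth"` (0); `lean search` for Euler self-similar profile decls (none in tree);
crossref `lit cite` of Yorke1969,
Kuperberg1996, Chae2007CMPEuler, EtnyreGhrist2000 (added to references.bib); `lit read
arxiv:2511.16254 --grep outgoing` (Elgindi 2025,
Hyp. 6.7: outgoing needed by the construction meta-theorem); the card's own searches (galaxy "closed
vortex lines" /
"topological entropy of the vorticity" 0 relevant, arXiv/S2/zbMATH as listed on the card) and the
refuter audit AUDIT-17-g2 (zbMATH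
'Chae self-similar Euler' 25 rows, crossref Yorke: no fluid use). `lit search --hybrid --no-graph
"closed vortex lines period self-similar blow-up Euler"` (8 textbook hits: Majda–Bertozzi
pp.329–402,
Acheson, Cottet — vortex stretching/BKM, none on periods of vortex lines as an obstruction); `lit
vsearch --no-graph "vector field conjugate
to a constant multiple of itself has no periodic orbits Yorke period bound"` (8 generic dynamics
textbo  [refs: 10.1007/s00220-007-0249-8:, 2602.17570, 2511.16254, arxiv:2602.17570, arxiv:2511.16254, doi:10.1007/s00220-007-0249-8, Yorke1969, Kuperberg1996, EtnyreGhrist2000, ChaeShvydkoy2013, Seregin2024]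

Barriers (technique_class: lagrangian-invariants dynamical-rigidity euler-scaling): - technique_class: lagrangian-invariants dynamical-rigidity euler-scaling
- Literature.Barriers.NavierStokesRegularity.TaoAveragedBlowup: evaded by the Euler-side items —
exact Lie transport of vorticity and the topology of its integral curves are structure of B(u,u) =
P(ω×u) that an averaged bilinear form does not have (Tao 2016 §1.1 lists vorticity-geometric
arguments as outside the barrier); NOT evaded by TypeIIWindowCore as a bare classification claim —
the bet is that it is attacked by vorticity-transport compactness/rigidity, not by energy + harmonic
analysis.
- Literature.Barriers.NavierStokesRegularity.TruncatedDyadicBlowup: same remark — the target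
NoTypeII is a rate statement, false for dyadic/averaged models; the route claims it only through an
equation-specific structural dichotomy.
- Literature.Barriers.NavierStokesRegularity.EnergySupercriticality: evaded in kind (the clocks are
dimensionless conjugacy invariants, not coercive norms; the flux count uses decay, not energy) but
conceded in scope: they act only on inviscid Type-II cores; the Type-I half is imported
(NoTypeIBlowup) and stays with the Liouville programme; CIV's γ ≥ 2/5 is the only energy input.
- Literature.Barriers.NavierStokesRegularity.LeraySelfSimilarBlowupExclusion: complementary — that
entry's tools (NRŠ/Tsai, γ = 1/2, viscous) do not reach γ < 1/2 inviscid profiles; nothing here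
relies on or contradicts it.
- Literature.Barriers.NavierStokesRegularity.AxisymmetricTypeIExclusion: consistent — a

sub-problem: NavierStokesRegularity · status: open · opened planner-plancard-NavierStokesRegularity-Navie-6e444d3d-0 2026-08-15T16:59:15Z · rev 0 · ledger route-NavierStokesRegularity-VortexLineClock
GENERATED by the gate from the ledger (D-0016/17). Provers cite these decls: `theorem foo : Summit.NavierStokesRegularity.NavierStokesRegularity.Theses.VortexLineClock.<Decl> := …` in Summits/NavierStokesRegularity/NavierStokesRegularity/Theorems/<Name>.lean.
-/

namespace Summit.NavierStokesRegularity.NavierStokesRegularity.Theses.VortexLineClock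

open scoped BigOperators Topology Manifold Classical MeasureTheory ProbabilityTheory Matrix InnerProductSpace ComplexConjugate ContinuousMap
open Filter Set Function TopologicalSpace MeasureTheory

attribute [summit_statement] _root_.NavierStokesRegularity

open Literature.NS

/-- item stmt-NavierStokesRegularity-0056 · target · rank 0 · open · by planner
why it might fail: a finite-energy Type-II singularity (= ¬Clay A); Tao's averaged blow-up is Type II (arXiv:1402.0290 p.8 fn.), Hou's axisymmetric scenario (arXiv:2107.06509) would be Type II if singular.
sources: Tao2016AveragedNS, Hou2022PotentiallySingularNS, KochNadirashviliSereginSverak2009, Seregin2024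
If a finite-energy classical solution from a rapidly decaying datum has maximal lifespan T<∞ (no
classical extension past T), then ‖u(t)‖_∞ ≤ C (T−t)^{-1/2} eventually as t↑T (Leray's rate is the
matching lower bound, leray_blowup_rate_top). The hardest and most informative crux: a
counterexample is a Type II singularity, i.e. ¬(Clay A). Known: lower bound c√ν (T−t)^{-1/2} (Leray
1934 §20); L³ must blow up (ESS 2003, Seregin 2012); only triple-log quantitative gain (Tao 2021). -/
@[route_item "route-NavierStokesRegularity-VortexLineClock"]
def NoTypeII : Prop :=
  ∀ (ν T : ℝ), 0 < ν → 0 < T → ∀ (u : ℝ → EuclideanSpace ℝ (Fin 3) → EuclideanSpace ℝ (Fin 3)) (p : ℝ → EuclideanSpace ℝ (Fin 3) → ℝ), Literature.Analysis.FluidPDE.IsMaximalSmoothSolution ν 0 u p T → Literature.Analysis.FluidPDE.IsLerayHopfOn T ν 0 (u 0) u → Literature.Analysis.FluidPDE.HasRapidSpatialDecay (u 0) → Literature.Analysis.FluidPDE.IsTypeIBlowup u T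

/-- item stmt-NavierStokesRegularity-11272 · crux · rank 2 · open · by planner
why it might fail: Type II may be wild, DSS or multiscale: Seregin's Euler-scaling limits are only weak ancient Euler flows with C⁰-velocity compactness; reconnection layers break C¹-vorticity convergence; an EXACT globally Lipschitz decaying profile is full asymptotic self-similarity.
sources: Seregin2024, arXiv:2304.04045, ConstantinIgnatovaVicol2026Putative, arXiv:2602.17570, Hou2022PotentiallySingularNS, ChaeShvydkoy2013
[crux] card K1 (INVISCID CORE EXTRACTION, typed in its exact-profile form): for ν, T > 0 and a
maximal classical solution (u,p) on [0,T) that is Leray–Hopf from a rapidly decaying datum and NOT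
Type I, there are γ, U, Ω with the WINDOW-PROFILE clauses (2/5 ≤ γ < 1/2; U C², Ω C¹; div U = 0; mΩ
= curl U for some m > 0; U, Ω globally Lipschitz; ∃ c, P: (1−γ)U + DU(γ(y−c)+U) + ∇P = 0 and
DΩ(γ(y−c)+U) − DU(Ω) = −Ω; |Ω(y)| ≤ C⟨y⟩^(−1/γ), |U(y)| ≤ C⟨y⟩^(1−1/γ); |Ω(0)| = 1) AND a zoom t_k ↑
T, x_k, A_k = |curl u(t_k)(x_k)| → ∞, half-max core radii ℓ_k → 0, isometries Q_k, with A_k ℓ_k²/ν →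
∞ and y ↦ A_k⁻¹ Q_k⁻¹ curl u(t_k)(x_k + ℓ_k Q_k y) → Ω in C¹ on every ball. [difficulty:
open-problem] -/
@[route_item "route-NavierStokesRegularity-VortexLineClock", crux]
def TypeIIWindowCore : Prop :=
  ∀ (ν T : ℝ), 0 < ν → 0 < T → ∀ (u : ℝ → EuclideanSpace ℝ (Fin 3) → EuclideanSpace ℝ (Fin 3)) (p : ℝ → EuclideanSpace ℝ (Fin 3) → ℝ), Literature.Analysis.FluidPDE.IsMaximalSmoothSolution ν 0 u p T → Literature.Analysis.FluidPDE.IsLerayHopfOn T ν 0 (u 0) u → Literature.Analysis.FluidPDE.HasRapidSpatialDecay (u 0) → ¬ Literature.Analysis.FluidPDE.IsTypeIBlowup u T → ∃ (γ : ℝ) (U Ω : EuclideanSpace ℝ (Fin 3) → EuclideanSpace ℝ (Fin 3)), ((2 / 5 : ℝ) ≤ γ ∧ γ < 1 / 2 ∧ ContDiff ℝ 2 U ∧ ContDiff ℝ 1 Ω ∧ Literature.Analysis.FluidPDE.VectorCalculus.IsDivFree U ∧ (∃ m : ℝ, 0 < m ∧ ∀ y, m • Ω y = Literature.Analysis.FluidPDE.curl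 U y) ∧ (∃ L : NNReal, LipschitzWith L U ∧ LipschitzWith L Ω) ∧ (∃ (c : EuclideanSpace ℝ (Fin 3)) (P : EuclideanSpace ℝ (Fin 3) → ℝ), ContDiff ℝ 1 P ∧ (∀ y, (1 - γ) • U y + fderiv ℝ U y (γ • (y - c) + U y) + gradient P y = 0) ∧ (∀ y, fderiv ℝ Ω y (γ • (y - c) + U y) - fderiv ℝ U y (Ω y) = -(Ω y))) ∧ (∃ C : ℝ, ∀ y, ‖Ω y‖ ≤ C * (1 + ‖y‖) ^ (-(1 / γ)) ∧ ‖U y‖ ≤ C * (1 + ‖y‖) ^ (1 - 1 / γ)) ∧ ‖Ω 0‖ = 1) ∧ ∃ (t : ℕ → ℝ) (x : ℕ → EuclideanSpace ℝ (Fin 3)) (A ℓ : ℕ → ℝ) (Q : ℕ → (EuclideanSpace ℝ (Fin 3) ≃ₗᵢ[ℝ] EuclideanSpace ℝ (Fin 3))), (∀ k, 0 ≤ t k ∧ t k < T) ∧ Filter.Tendsto t Filter.atTop (nhds T) ∧ (∀ k, 0 < A k ∧ 0 < ℓ k) ∧ Filter.Tendsto A Filter.atTop Filter.atTop ∧ Filter.Tendsto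 ℓ Filter.atTop (nhds 0) ∧ (∀ k, ‖Literature.Analysis.FluidPDE.curl (u (t k)) (x k)‖ = A k) ∧ (∀ k, (∀ z, dist z (x k) < ℓ k → A k / 2 < ‖Literature.Analysis.FluidPDE.curl (u (t k)) z‖) ∧ ∃ z, dist z (x k) = ℓ k ∧ ‖Literature.Analysis.FluidPDE.curl (u (t k)) z‖ ≤ A k / 2) ∧ Filter.Tendsto (fun k => A k * ℓ k ^ 2 / ν) Filter.atTop Filter.atTop ∧ ∀ R ε : ℝ, 0 < R → 0 < ε → ∃ k₀ : ℕ, ∀ k ≥ k₀, ∀ y : EuclideanSpace ℝ (Fin 3), ‖y‖ ≤ R → ‖(A k)⁻¹ • (Q k).symm (Literature.Analysis.FluidPDE.curl (u (t k)) (x k + ℓ k • Q k y)) - Ω y‖ + ‖fderiv ℝ (fun y' => (A k)⁻¹ • (Q k).symm (Literature.Analysis.FluidPDE.curl (u (t k)) (x k + ℓ k • Q k y'))) y - fderiv ℝ Ω y‖ ≤ ε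

/-- item stmt-NavierStokesRegularity-11273 · crux · rank 3 · open · by planner
why it might fail: a Lipschitz window profile with saddle-type (non-outgoing) stagnation points may exist — constructions need outgoing (arXiv:2511.16254 Hyp. 6.7) but nothing forbids it; the dynamical proof needs a closing lemma false for general C¹ volume-preserving flows (Kuperberg1996).
sources: ConstantinIgnatovaVicol2026Putative, arXiv:2602.17570, arXiv:2511.16254, ChaeShvydkoy2013, Chae2007CMPEuler, Elgindi2021AnnMath
[crux] THE EULER WINDOW IS EMPTY: there is no (γ, U, Ω) satisfying the window-profile clauses of
TypeIIWindowCore — no exact self-similar Euler blow-up profile with 2/5 ≤ γ < 1/2, Lipschitz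
normalised vorticity and CIV matched decay. Known: γ ≥ 2/5 is forced by finite energy (CIV Thm 2.1);
under the local OUTGOING property γ ≥ 1/2 (CIV Thms 3.8, 3.10), axisymmetric cases (CIV Thms 4.4,
4.6); open: profiles whose self-similar Lagrangian field V = γ(y−c)+U has non-outgoing stagnation
points or an infinite nodal set. Intended proof = WindowGlue: FluxCapacityRecurrence →
SeifertResidual → ProfileClockNoCycle. [difficulty: open-problem] -/
@[route_item "route-NavierStokesRegularity-VortexLineClock", crux]
def EmptyEulerWindow : Prop :=
  ∀ (γ : ℝ) (U Ω : EuclideanSpace ℝ (Fin 3) → EuclideanSpace ℝ (Fin 3)), ¬ ((2 / 5 : ℝ) ≤ γ ∧ γ < 1 / 2 ∧ ContDiff ℝ 2 U ∧ ContDiff ℝ 1 Ω ∧ Literature.Analysis.FluidPDE.VectorCalculus.IsDivFree U ∧ (∃ m : ℝ, 0 < m ∧ ∀ y, m • Ω y = Literature.Analysis.FluidPDE.curl U y) ∧ (∃ L : NNReal, LipschitzWith L U ∧ LipschitzWith L Ω) ∧ (∃ (c : EuclideanSpace ℝ (Fin 3)) (P : EuclideanSpace ℝ (Fin 3) → ℝ),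 ContDiff ℝ 1 P ∧ (∀ y, (1 - γ) • U y + fderiv ℝ U y (γ • (y - c) + U y) + gradient P y = 0) ∧ (∀ y, fderiv ℝ Ω y (γ • (y - c) + U y) - fderiv ℝ U y (Ω y) = -(Ω y))) ∧ (∃ C : ℝ, ∀ y, ‖Ω y‖ ≤ C * (1 + ‖y‖) ^ (-(1 / γ)) ∧ ‖U y‖ ≤ C * (1 + ‖y‖) ^ (1 - 1 / γ)) ∧ ‖Ω 0‖ = 1)

/-- item stmt-NavierStokesRegularity-11274 · crux · rank 4 · open · by planner
why it might fail: a Type-II blow-up could keep every intense vorticity core at the viscous scale (|ω|ℓ² ≲ ν: sheets/filaments of Kolmogorov thickness) while ‖u‖∞ outruns (T−t)^(−1/2) by accumulation of many cores (cascade-like); no known estimate ties the rate to the core Reynolds number.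
sources: Seregin2024, arXiv:2304.04045, Hou2022PotentiallySingularNS, KochNadirashviliSereginSverak2009, ConstantinIgnatovaVicol2026Putative
[crux] TYPE II HAS AN INVISCID VORTICITY CORE (the first, zoom-free consequence of TypeIIWindowCore;
Sketch.lean `inviscidCore_of_windowCore`): for a maximal Leray–Hopf classical solution from rapidly
decaying data with non-Type-I rate, for every K and every t₀ < T there are t ∈ (t₀,T), a point x and
its half-max vorticity core radius ℓ (|curl u(t)| > |curl u(t)(x)|/2 on the open ball B(x,ℓ), ≤ at
some point of its boundary sphere) with |curl u(t)(x)| ≥ K and local Reynolds number |curl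
u(t)(x)|·ℓ²/ν ≥ K. [difficulty: L] -/
@[route_item "route-NavierStokesRegularity-VortexLineClock"]
def InviscidVorticityCore : Prop :=
  ∀ (ν T : ℝ), 0 < ν → 0 < T → ∀ (u : ℝ → EuclideanSpace ℝ (Fin 3) → EuclideanSpace ℝ (Fin 3)) (p : ℝ → EuclideanSpace ℝ (Fin 3) → ℝ), Literature.Analysis.FluidPDE.IsMaximalSmoothSolution ν 0 u p T → Literature.Analysis.FluidPDE.IsLerayHopfOn T ν 0 (u 0) u → Literature.Analysis.FluidPDE.HasRapidSpatialDecay (u 0) → ¬ Literature.Analysis.FluidPDE.IsTypeIBlowup u T → ∀ K : ℝ, ∀ t₀ < T, ∃ t, t₀ < t ∧ t < T ∧ ∃ (x : EuclideanSpace ℝ (Fin 3)) (ℓ : ℝ), 0 < ℓ ∧ K ≤ ‖Literature.Analysis.FluidPDE.curl (u t) x‖ ∧ (∀ z, dist z x < ℓ → ‖Literature.Analysis.FluidPDE.curl (u t) x‖ / 2 < ‖Literature.Analysis.FluidPDE.curl (u t) z‖) ∧ (∃ z, dist z x = ℓ ∧ ‖Literature.Analysis.FluidPDE.curl (u t) z‖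 ≤ ‖Literature.Analysis.FluidPDE.curl (u t) x‖ / 2) ∧ K * ν ≤ ‖Literature.Analysis.FluidPDE.curl (u t) x‖ * ℓ ^ 2

/-- item stmt-NavierStokesRegularity-0055 · support · rank 9 · open · by planner
sources: Leray1934, KochNadirashviliSereginSverak2009, Fefferman2000
Given NoBlowup, build the Clay (A) solution: local finite-energy classical solution for smooth
divergence-free rapidly decaying data (Leray 1934 §III / Fujita–Kato 1964 + LPS smoothing), continue
past every T using NoBlowup, glue by weak–strong uniqueness (Prodi–Serrin), bounded energy from the
energy inequality, and convert with
Literature.Analysis.FluidPDE.isNavierStokesSolution_and_smooth_iff. Blow-up at spatial infinity is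
excluded by CKN ε-regularity applied far out. May take named Literature facts (leray_existence_R3,
ladyzhenskaya_prodi_serrin, weak_strong_uniqueness, fujita_kato_local) as hypotheses if the grounder
so rules. -/
@[route_item "route-NavierStokesRegularity-VortexLineClock"]
def NoBlowupToClay : Prop :=
  (∀ (ν T : ℝ), 0 < ν → 0 < T → ∀ (u : ℝ → EuclideanSpace ℝ (Fin 3) → EuclideanSpace ℝ (Fin 3)) (p : ℝ → EuclideanSpace ℝ (Fin 3) → ℝ), Literature.Analysis.FluidPDE.IsClassicalNSSolutionOn (Set.Ico 0 T) ν 0 u p → Literature.Analysis.FluidPDE.IsLerayHopfOn T ν 0 (u 0) u → Literature.Analysis.FluidPDE.HasRapidSpatialDecay (u 0) → Literature.Analysis.FluidPDE.HasSmoothExtensionPast ν 0 u T) → NavierStokesRegularity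

/-- item stmt-NavierStokesRegularity-11275 · support · rank 9 · open · by planner
sources: Kuperberg1996, EtnyreGhrist2000, ConstantinIgnatovaVicol2026Putative
[support] card K2 (SEIFERT RESIDUAL), the open residual form of EmptyEulerWindow: a window profile
(clauses as in TypeIIWindowCore) whose vortex-line flow is a.e. recurrent on {Ω ≠ 0} (the conclusion
of FluxCapacityRecurrence) has a closed vortex line: a τ-periodic solution of x' = Ω(x), τ > 0,
through a point where Ω ≠ 0. Engines: contact/Reeb structure where U·Ω ≠ 0 (EtnyreGhrist2000), twist
⇒ Poincaré–Birkhoff, the affine pair [V,Ω] = −(1+γ)Ω transporting recurrence to infinity,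
analyticity at Lagrangian stagnation points (CIV Prop 3.9). [difficulty: open-problem] -/
@[route_item "route-NavierStokesRegularity-VortexLineClock"]
def SeifertResidual : Prop :=
  ∀ (γ : ℝ) (U Ω : EuclideanSpace ℝ (Fin 3) → EuclideanSpace ℝ (Fin 3)), ((2 / 5 : ℝ) ≤ γ ∧ γ < 1 / 2 ∧ ContDiff ℝ 2 U ∧ ContDiff ℝ 1 Ω ∧ Literature.Analysis.FluidPDE.VectorCalculus.IsDivFree U ∧ (∃ m : ℝ, 0 < m ∧ ∀ y, m • Ω y = Literature.Analysis.FluidPDE.curl U y) ∧ (∃ L : NNReal, LipschitzWith L U ∧ LipschitzWith L Ω) ∧ (∃ (c : EuclideanSpace ℝ (Fin 3)) (P : EuclideanSpace ℝ (Fin 3) → ℝ), ContDiff ℝ 1 P ∧ (∀ y, (1 - γ) • U y + fderiv ℝ U y (γ • (y - c) + U y) + gradient P y = 0) ∧ (∀ y, fderiv ℝ Ω y (γ • (y - c) + U y) - fderiv ℝ U y (Ω y) = -(Ω y))) ∧ (∃ C : ℝ, ∀ y, ‖Ω y‖ ≤ C * (1 + ‖y‖) ^ (-(1 / γ)) ∧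 ‖U y‖ ≤ C * (1 + ‖y‖) ^ (1 - 1 / γ)) ∧ ‖Ω 0‖ = 1) → (∀ᵐ y : EuclideanSpace ℝ (Fin 3), Ω y ≠ 0 → ∀ x : ℝ → EuclideanSpace ℝ (Fin 3), x 0 = y → (∀ s, HasDerivAt x (Ω (x s)) s) → ∀ ε : ℝ, 0 < ε → ∀ S : ℝ, ∃ s, S < s ∧ dist (x s) y < ε) → ∃ (x : ℝ → EuclideanSpace ℝ (Fin 3)) (τ : ℝ), 0 < τ ∧ (∀ s, HasDerivAt x (Ω (x s)) s) ∧ (∀ s, x (s + τ) = x s) ∧ Ω (x 0) ≠ 0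

/-- item stmt-NavierStokesRegularity-11276 · support · rank 9 · open · by planner
sources: ConstantinIgnatovaVicol2026Putative, MajdaBertozzi2002, Kuperberg1996
[support] card P3, corrected from 'bounded' to 'recurrent' (FLUX CAPACITY): for a window profile,
div Ω = 0, Ω is globally Lipschitz (complete volume-preserving vortex-line flow) and ∫_(S_R) |Ω| dσ
≤ 4πC R^(2−1/γ) → 0 (1/γ > 2), so the forward-escaping set is Lebesgue-null (last-exit flux count:
vol ≤ (occupation bound)² × flux → 0), the flow is conservative, and by Poincaré–Halmos recurrence
a.e. point y with Ω(y) ≠ 0 returns arbitrarily close to itself at arbitrarily late times along its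
(unique) vortex line. [difficulty: provable-now] -/
@[route_item "route-NavierStokesRegularity-VortexLineClock"]
def FluxCapacityRecurrence : Prop :=
  ∀ (γ : ℝ) (U Ω : EuclideanSpace ℝ (Fin 3) → EuclideanSpace ℝ (Fin 3)), ((2 / 5 : ℝ) ≤ γ ∧ γ < 1 / 2 ∧ ContDiff ℝ 2 U ∧ ContDiff ℝ 1 Ω ∧ Literature.Analysis.FluidPDE.VectorCalculus.IsDivFree U ∧ (∃ m : ℝ, 0 < m ∧ ∀ y, m • Ω y = Literature.Analysis.FluidPDE.curl U y) ∧ (∃ L : NNReal, LipschitzWith L U ∧ LipschitzWith L Ω) ∧ (∃ (c : EuclideanSpace ℝ (Fin 3)) (P : EuclideanSpace ℝ (Fin 3) → ℝ), ContDiff ℝ 1 P ∧ (∀ y, (1 - γ) • U y + fderiv ℝ U y (γ • (y - c) + U y) + gradient P y = 0) ∧ (∀ y, fderiv ℝ Ω y (γ • (y - c) + U y) - fderiv ℝ U y (Ω y) = -(Ω y))) ∧ (∃ C : ℝ, ∀ y, ‖Ω y‖ ≤ C * (1 + ‖y‖) ^ (-(1 / γ)) ∧ ‖U y‖ ≤ C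 * (1 + ‖y‖) ^ (1 - 1 / γ)) ∧ ‖Ω 0‖ = 1) → ∀ᵐ y : EuclideanSpace ℝ (Fin 3), Ω y ≠ 0 → ∀ x : ℝ → EuclideanSpace ℝ (Fin 3), x 0 = y → (∀ s, HasDerivAt x (Ω (x s)) s) → ∀ ε : ℝ, 0 < ε → ∀ S : ℝ, ∃ s, S < s ∧ dist (x s) y < ε

/-- item stmt-NavierStokesRegularity-11277 · support · rank 9 · open · by planner
sources: Yorke1969, ConstantinIgnatovaVicol2026Putative, arXiv:2602.17570
[support] card P2 (EXACT-PROFILE CLOCK THEOREM, stated for the bare affine structure): if U, Ω ∈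
C¹(ℝ³;ℝ³) are globally Lipschitz, γ ≠ −1, and DΩ(γ(y−c)+U) − DU(Ω) = −Ω (i.e. [V,Ω] = −(1+γ)Ω for
the complete field V = γ(y−c)+U), then x' = Ω(x) has no non-stationary periodic orbit: the flow Ψ_τ
of V maps Ω-orbits to Ω-orbits with periods multiplied by e^(−(1+γ)τ) (d/ds Ψ_τ(x(s)) = e^((1+γ)τ)
Ω(Ψ_τ(x(s))) by uniqueness for the linearised equation), so one closed vortex line of period p gives
closed lines of every period p·e^(−(1+γ)τ), contradicting YorkePeriodBound. [difficulty:
provable-now] -/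
@[route_item "route-NavierStokesRegularity-VortexLineClock"]
def ProfileClockNoCycle : Prop :=
  ∀ (γ : ℝ) (c : EuclideanSpace ℝ (Fin 3)) (U Ω : EuclideanSpace ℝ (Fin 3) → EuclideanSpace ℝ (Fin 3)), γ ≠ -1 → ContDiff ℝ 1 U → ContDiff ℝ 1 Ω → (∃ L : NNReal, LipschitzWith L U ∧ LipschitzWith L Ω) → (∀ y, fderiv ℝ Ω y (γ • (y - c) + U y) - fderiv ℝ U y (Ω y) = -(Ω y)) → ¬ ∃ (x : ℝ → EuclideanSpace ℝ (Fin 3)) (τ : ℝ), 0 < τ ∧ (∀ s, HasDerivAt x (Ω (x s)) s) ∧ (∀ s, x (s + τ) = x s) ∧ Ω (x 0) ≠ 0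

/-- item stmt-NavierStokesRegularity-11278 · support · rank 9 · open · by planner
sources: Yorke1969
[support] Yorke 1969: a non-stationary τ-periodic solution of x' = F(x) with F L-Lipschitz on ℝ³ has
τ ≥ 2π/L (Wirtinger's inequality applied to x', whose derivative is a.e. bounded by L|x'|).
[difficulty: provable-now] -/
@[route_item "route-NavierStokesRegularity-VortexLineClock"]
def YorkePeriodBound : Prop :=
  ∀ (F : EuclideanSpace ℝ (Fin 3) → EuclideanSpace ℝ (Fin 3)) (L : NNReal), LipschitzWith L F → ∀ (x : ℝ → EuclideanSpace ℝ (Fin 3)) (τ : ℝ), 0 < τ → (∀ s, HasDerivAt x (F (x s)) s) → (∀ s, x (s + τ) = x s) → F (x 0) ≠ 0 → 2 * Real.pi / (L : ℝ) ≤ τ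

/-- item stmt-NavierStokesRegularity-11279 · support · rank 9 · open · by planner
sources: MajdaBertozzi2002, Yorke1969, Chae2007CMPEuler, CordobaFefferman2001
[support] card P1 (EULER CLOCK THEOREM): for a classical Euler solution on ℝ³ × [0,T) with velocity
gradient bounded on compact sub-intervals (so the Lagrangian flow is a C¹ diffeomorphism and the
Cauchy formula ω(t)∘Φ_t = DΦ_t·ω₀ holds), and ‖∇ω₀‖∞ ≤ L, every closed vortex line of ω(t) = curl
u(t), 0 ≤ t < T, has period ∮ds/|ω| ≥ 2π/L: periods are conjugacy invariants of the frozen line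
field and Yorke bounds them at t = 0. The mechanism at home; corollary: no C¹_loc-asymptotically
self-similar Euler blow-up whose profile carries a non-degenerate closed vortex line. [difficulty:
provable-now] -/
@[route_item "route-NavierStokesRegularity-VortexLineClock"]
def EulerClockBound : Prop :=
  ∀ (T : ℝ), 0 < T → ∀ (u : ℝ → EuclideanSpace ℝ (Fin 3) → EuclideanSpace ℝ (Fin 3)) (p : ℝ → EuclideanSpace ℝ (Fin 3) → ℝ), Literature.Analysis.FluidPDE.IsClassicalEulerSolutionOn (Set.Ico 0 T) 0 u p → (∀ T' < T, ∃ K : ℝ, ∀ t ∈ Set.Icc 0 T', ∀ y, ‖fderiv ℝ (u t) y‖ ≤ K) → ∀ (L : NNReal), LipschitzWith L (Literature.Analysis.FluidPDE.curl (u 0)) → ∀ t ∈ Set.Ico 0 T, ∀ (x : ℝ → EuclideanSpace ℝ (Fin 3)) (τ : ℝ), 0 < τ → (∀ s, HasDerivAt x (Literature.Analysis.FluidPDE.curl (u t) (x s)) s) → (∀ s, x (s + τ) = x s) → Literature.Analysis.FluidPDE.curl (u t) (x 0) ≠ 0 → 2 * Real.pi / (L : ℝ) ≤ τ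

/-- item stmt-NavierStokesRegularity-11280 · support · rank 9 · open · by planner
sources: ConstantinIgnatovaVicol2026Putative
[support] pure-logic glue of the Euler side (proved in Sketch.lean `windowGlue_holds`):
FluxCapacityRecurrence → SeifertResidual → ProfileClockNoCycle → EmptyEulerWindow (unpack the window
clauses; γ ≠ −1 from 2/5 ≤ γ). [difficulty: provable-now] -/
@[route_item "route-NavierStokesRegularity-VortexLineClock"]
def WindowGlue : Prop :=
  FluxCapacityRecurrence → SeifertResidual → ProfileClockNoCycle → EmptyEulerWindow

/-- item stmt-NavierStokesRegularity-1217 · support · rank 9 · open · by planner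
sources: KochNadirashviliSereginSverak2009, AlbrittonBarker2019, SereginSverak2009
[target] X = NO TYPE-I BLOW-UP FOR CLAY DATA: a classical solution of unforced NS on ℝ³×[0,T) which
is Leray–Hopf from a rapidly decaying datum and blows up at most at the Type-I rate ‖u(t)‖∞ ≤
C(T−t)^{-1/2} extends smoothly past T. Equals UnthreadedNoBlowup ∧ ThreadedNoBlowup by excluded
middle on 'every point is unthreaded' (proved in the planner's Sketch.lean: target_of_cruxes); it is
the unconditional conclusion of stmt-NavierStokesRegularity-0058 (route TypeILiouville, which
assumes (L)). With NoTypeII (stmt-0056) it gives NoBlowup (stmt-0054). Card: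
threading-flux-trace-topology. -/
@[route_item "route-NavierStokesRegularity-VortexLineClock", crux]
def NoTypeIBlowup : Prop :=
  ∀ (ν T : ℝ), 0 < ν → 0 < T → ∀ (u : ℝ → EuclideanSpace ℝ (Fin 3) → EuclideanSpace ℝ (Fin 3)) (p : ℝ → EuclideanSpace ℝ (Fin 3) → ℝ), Literature.Analysis.FluidPDE.IsClassicalNSSolutionOn (Set.Ico 0 T) ν 0 u p → Literature.Analysis.FluidPDE.IsLerayHopfOn T ν 0 (u 0) u → Literature.Analysis.FluidPDE.HasRapidSpatialDecay (u 0) → Literature.Analysis.FluidPDE.IsTypeIBlowup u T → Literature.Analysis.FluidPDE.HasSmoothExtensionPast ν 0 u T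

/-- item stmt-NavierStokesRegularity-11281 · assembly · rank 1 · open · by planner
sources: KochNadirashviliSereginSverak2009, ConstantinIgnatovaVicol2026Putative
[assembly] TypeIIWindowCore → EmptyEulerWindow → NoTypeIBlowup → NoBlowupToClay →
NavierStokesRegularity (theorem assembly_holds in Sketch.lean). -/
@[route_item "route-NavierStokesRegularity-VortexLineClock"]
def Assembly : Prop :=
  TypeIIWindowCore → EmptyEulerWindow → NoTypeIBlowup → NoBlowupToClay → NavierStokesRegularity

/-! D-0027 §2.1 — DECIDING THEOREM (planner-authored via `route open/edit --closes-file`; by planner-plancard-NavierStokesRegularity-Navie-6e444d3d-0 2026-08-15T16:59:17Z):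
its hypotheses are this route's items and its conclusion the sub-problem Statement (glue_lint), and it elaborates with this file. -/

@[closes "route-NavierStokesRegularity-VortexLineClock"] theorem closes (h₁ : TypeIIWindowCore) (h₂ : EmptyEulerWindow) (h₃ : NoTypeIBlowup) (h₄ : NoBlowupToClay) : NavierStokesRegularity := by
  apply h₄
  intro ν T hν hT u p hcl hLH hdec
  by_contra hext
  have hmax : Literature.Analysis.FluidPDE.IsMaximalSmoothSolution ν 0 u p T := ⟨hcl, hext⟩
  by_cases hI : Literature.Analysis.FluidPDE.IsTypeIBlowup u T
  · exact hext (h₃ ν T hν hT u p hcl hLH hdec hI)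
  · obtain ⟨γ, U, Ω, hW, -⟩ := h₁ ν T hν hT u p hmax hLH hdec hI
    exact h₂ γ U Ω hW

end Summit.NavierStokesRegularity.NavierStokesRegularity.Theses.VortexLineClock
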